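/-
Copyright (c) 2026 the pub-hodgecm-mathlib formalisation cell (harness21).  Prover seat hodgecm-mathlib-F0P2-p08 (g3), Track B «K2-LIT»,
#184♮ = hLiu418 = `stmt-HodgeConjecture-24832`; socket #41 `sig_K2LiuSiegelEisensteinContinuation`, KIND W, brick (iii-arch-zero): the archimedean letters `hFinf`,
`hFinf0`, `hFinfI` of ★ (ii)′ `kindW_block_cm_of_letters` ∕ ★ ED. 4 for the reading `Finf := if det S = 0 then 0 else kindWArchLetter …` (★ p863152).
THEOREMS ONLY (no `def`, no `instance`, no notation, no named-fact hypothesis, no `sorry`).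
-/
import Summits.HodgeConjecture.HodgeConjecture.Theorems.K2LiuKindWArchLetterDefs   -- ★ p863152 `kindWArchLetter`, `differentiableOn_kindWArchLetter`, `kindWArchLetter_eq_integral`
import HarnessLib

/-!
# Crux `HLiu418`, socket #41, KIND W — brick (iii-arch-zero) `K2LiuKindWArchLetterAtZero`: THE CONTINUED ARCHIMEDEAN LETTER READ AS `0` AT SINGULAR INDICES
# `Finf j S s h := if det S = 0 then 0 else kindWArchLetter … j S s h` satisfies `hFinf` (holomorphy), `hFinf0` (the convention) and, under `hex`, `hFinfI`

Cell `hodgecm-mathlib`, crux item hLiu418 = `stmt-HodgeConjecture-24832` (helper lane `--supports … --as helper`, count-neutral), route of record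
`HCCMUnconditional`; squad K2 ∕ K2Liu, road `K2_Liu`, socket #41, KIND W; KW desk of record F0P2-p08 (g3).  ★ (ii)′ p863329 `kindW_block_cm_of_letters` ∕ 📤
`kindW_block_cm_of_localLetters` take the continued archimedean letters `Finf` BY VALUE with THREE letters: `hFinf` (holomorphy on `{0 < re s}`), `hFinfI` (= the archimedean
Whittaker integral on `{n∕2 < re s}`, `det S ≠ 0`) and the CONVENTION `hFinf0` (`Finf j S s h = 0` at `det S = 0` — the KIND-W letters are read only at non-singular indices; ★
p863137 `harch_of_blockLetters` quantifies over all `S`).  ★ p863152 `K2LiuKindWArchLetterDefs.kindWArchLetter` (LH4-p08) pays `hFinf` unconditionally and `hFinfI` under the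
per-`(j,S,h)` existence letter `hex`, but is not `0` at singular `S`.  THIS FILE reads the letter as **`Finf j S s h := if det ↑S = 0 then 0 else kindWArchLetter … j S s h`**
(hypothesis `hread`, pointwise; the tie passes its own `Finf` and `fun … => rfl`) and pays all three: `hFinf_of_reading` (by cases: the constant `0` ∕ ★
`differentiableOn_kindWArchLetter`), `hFinf0_of_reading` (`if_pos`), `hFinfI_of_reading` (`if_neg` + ★ `kindWArchLetter_eq_integral` under `hex`) — in ★ (ii)′'s ∕ ★ ED. 4's
binder BYTES (generic `n`, datum `e : Fin N × Fin M ≃ Fin n`).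
[MoeglinWaldspurger1995, II.1.7, IV.1.9] [KudlaRallis1994, §1] [Shimura1997, §18.4].
HONEST LABEL.  Count-neutral helper; closes no socket by itself: `HC_CM` is proved only modulo the 7 printed citations (2 remaining named inputs:
hLiu418 = `stmt-HodgeConjecture-24832`, h413 = `stmt-HodgeConjecture-24833`) until rung 0 closes.  NOT HERE (by value): the existence letter `hex` (★ FILE A + (x-a-pres)(ii)).

## References
* [MoeglinWaldspurger1995] C. Mœglin, J.-L. Waldspurger, *Spectral Decomposition and Eisenstein Series* (1995): II.1.7, IV.1.9.
* [KudlaRallis1994] S. Kudla, S. Rallis, Ann. of Math. 140 (1994): §1.   * [Shimura1997] G. Shimura, CBMS 93 (1997): §18.4.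
-/

set_option autoImplicit false
-- the mandated namespace repeats the single-problem summit's segment (`HodgeConjecture.HodgeConjecture`)
set_option linter.dupNamespace false

noncomputable section

open scoped Matrix ComplexConjugate Classical
open NumberField IsDedekindDomain Matrix MeasureTheory Measure Set
open Literature.NumberTheory.Automorphic Literature.NumberTheory.Automorphic.UnitaryGroup Literature.NumberTheory.GaloisRepresentations
open Literature.NumberTheory.GelbartRogawski1991 Literature.NumberTheory.GelbartRogawski1991.GRConstruction
open Literature.NumberTheory.K2Lit Literature.NumberTheory.K2Lit.SiegelDoubled Literature.NumberTheory.K2Lit.PlaceSplitting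
open Summit.HodgeConjecture.HodgeConjecture.Cruxes.HLiu418.K2LiuSiegelUnipotentFourierDefs
open Summit.HodgeConjecture.HodgeConjecture.Cruxes.HLiu418.K2LiuSiegelUnipotentLocalDefs
open Summit.HodgeConjecture.HodgeConjecture.Cruxes.HLiu418.K2LiuSiegelUnipotentSplitDefs
open Summit.HodgeConjecture.HodgeConjecture.Cruxes.HLiu418.K2LiuSiegelEisensteinKindWLetters
open Summit.HodgeConjecture.HodgeConjecture.Cruxes.HLiu418.K2LiuKindWArchLetterDefs

namespace Summit.HodgeConjecture.HodgeConjecture.Cruxes.HLiu418.K2LiuKindWArchLetterAtZero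

variable (L : Type) [Field L] [NumberField L] [IsCMField L]
variable {N M n : ℕ} (e : Fin N × Fin M ≃ Fin n)
  (dV : Fin N → L) (hdV : ∀ i, IsCMField.complexConj L (dV i) = dV i)
  (dW : Fin M → L) (hdW : ∀ i, IsCMField.complexConj L (dW i) = dW i)
  [MeasurableSpace ↥(unipDeltaArch L e dV hdV dW hdW)]
  (νinf : Finset (HeightOneSpectrum (𝓞 (Fp L))) → Measure ↥(unipDeltaArch L e dV hdV dW hdW))
  (T₀ : Finset (HeightOneSpectrum (𝓞 (Fp L)))) {m : ℕ}
  (FinfT : Fin m → skewMatrices ((IsCMField.complexConj L : L ≃ₐ[Fp L] L) : L →+* L) ((gramR L e dV hdV dW hdW).map (algebraMap (Fp L) L)) →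
    HA L e dV hdV dW hdW → ℂ → UnitaryGroup.arch (Fp L) L (IsCMField.complexConj L) (n + n) (hermD L e dV hdV dW hdW) → ℂ)
  (Finf : Fin m → skewMatrices ((IsCMField.complexConj L : L ≃ₐ[Fp L] L) : L →+* L) ((gramR L e dV hdV dW hdW).map (algebraMap (Fp L) L)) → ℂ → HA L e dV hdV dW hdW → ℂ)
  (hread : ∀ (j : Fin m) (S : skewMatrices ((IsCMField.complexConj L : L ≃ₐ[Fp L] L) : L →+* L) ((gramR L e dV hdV dW hdW).map (algebraMap (Fp L) L))) (s : ℂ)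
    (h : HA L e dV hdV dW hdW), Finf j S s h = if (S : Matrix (Fin n) (Fin n) L).det = 0 then 0 else kindWArchLetter L e dV hdV dW hdW νinf T₀ FinfT j S s h)

include hread in
/-- **`hFinf` for the reading** (★ (ii)′ ∕ ★ ED. 4 bytes): `s ↦ Finf j S s h` is holomorphic on `{0 < re s}` — the constant `0` at singular `S`, ★
`differentiableOn_kindWArchLetter` otherwise. [cite: MoeglinWaldspurger1995, IV.1.9] -/
theorem hFinf_of_reading :
    ∀ j S (h : HA L e dV hdV dW hdW), DifferentiableOn ℂ (fun s => Finf j S s h) {s : ℂ | 0 < s.re} := by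
  intro j S h
  have hfun : (fun s => Finf j S s h) = fun s => if (S : Matrix (Fin n) (Fin n) L).det = 0 then 0 else kindWArchLetter L e dV hdV dW hdW νinf T₀ FinfT j S s h :=
    funext fun s => hread j S s h
  rw [hfun]
  by_cases hdet : (S : Matrix (Fin n) (Fin n) L).det = 0
  · simp only [hdet, if_true]
    exact differentiableOn_const 0
  · simp only [hdet, if_false]
    exact differentiableOn_kindWArchLetter L e dV hdV dW hdW νinf T₀ FinfT j S h

include hread in
/-- **`hFinf0` for the reading** (★ (ii)′ bytes): `Finf j S s h = 0` whenever `det ↑S = 0`. [cite: KudlaRallis1994, §1] -/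
theorem hFinf0_of_reading :
    ∀ (j : Fin m) (S : skewMatrices ((IsCMField.complexConj L : L ≃ₐ[Fp L] L) : L →+* L) ((gramR L e dV hdV dW hdW).map (algebraMap (Fp L) L)))
      (s : ℂ) (h : HA L e dV hdV dW hdW), (S : Matrix (Fin n) (Fin n) L).det = 0 → Finf j S s h = 0 := by
  intro j S s h hdet
  rw [hread j S s h, if_pos hdet]

include hread in
/-- **`hFinfI` for the reading, under the per-`(j,S,h)` existence letter `hex`** (★ ED. 4 :126–132 bytes): on `{n∕2 < re s}`, `det ↑S ≠ 0`, `Finf j S s h` IS the archimedean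
Whittaker integral of `FinfT j S h` at `h_∞` (`if_neg` + ★ `kindWArchLetter_eq_integral`). [cite: MoeglinWaldspurger1995, II.1.7, IV.1.9] [cite: Shimura1997, §18.4] -/
theorem hFinfI_of_reading
    (hex : ∀ (j : Fin m) (S : skewMatrices ((IsCMField.complexConj L : L ≃ₐ[Fp L] L) : L →+* L) ((gramR L e dV hdV dW hdW).map (algebraMap (Fp L) L)))
      (h : HA L e dV hdV dW hdW), (S : Matrix (Fin n) (Fin n) L).det ≠ 0 →
      ∃ F : ℂ → ℂ, DifferentiableOn ℂ F {s : ℂ | 0 < s.re} ∧ ∀ s : ℂ, (n : ℝ) / 2 < s.re → F s =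
        archWhittakerIntegral L e dV hdV dW hdW (νinf (kindWFinset L e dV hdV dW hdW T₀ (S : Matrix (Fin n) (Fin n) L) h)) (S : Matrix (Fin n) (Fin n) L)
          (FinfT j S h) (UnitaryGroup.archPart (Fp L) L (IsCMField.complexConj L) (n + n) (hermD L e dV hdV dW hdW) h) s) :
    ∀ (j : Fin m) (S : skewMatrices ((IsCMField.complexConj L : L ≃ₐ[Fp L] L) : L →+* L) ((gramR L e dV hdV dW hdW).map (algebraMap (Fp L) L)))
      (h : HA L e dV hdV dW hdW) (s : ℂ), (n : ℝ) / 2 < s.re → (S : Matrix (Fin n) (Fin n) L).det ≠ 0 →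
      Finf j S s h = ∫ a, conj (unipDeltaChar L e dV hdV dW hdW (S : Matrix (Fin n) (Fin n) L)
            (UnitaryGroup.archToAdelic (Fp L) L (IsCMField.complexConj L) (n + n) (hermD L e dV hdV dW hdW)
              (a : UnitaryGroup.arch (Fp L) L (IsCMField.complexConj L) (n + n) (hermD L e dV hdV dW hdW))) : ℂ) *
          FinfT j S h s (UnitaryGroup.archPart (Fp L) L (IsCMField.complexConj L) (n + n) (hermD L e dV hdV dW hdW) (weylDelta L e dV hdV dW hdW) *
              (a : UnitaryGroup.arch (Fp L) L (IsCMField.complexConj L) (n + n) (hermD L e dV hdV dW hdW)) *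
              UnitaryGroup.archPart (Fp L) L (IsCMField.complexConj L) (n + n) (hermD L e dV hdV dW hdW) h) ∂(νinf (kindWFinset L e dV hdV dW hdW T₀ (S : Matrix (Fin n) (Fin n) L) h)) := by
  intro j S h s hs hdet
  rw [hread j S s h, if_neg hdet]
  exact kindWArchLetter_eq_integral L e dV hdV dW hdW νinf T₀ FinfT hex j S h s hs hdet

end Summit.HodgeConjecture.HodgeConjecture.Cruxes.HLiu418.K2LiuKindWArchLetterAtZero

end
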